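import Summits.ResolutionOfSingularities.ResolutionOfSingularities.Theorems.FrobeniusClosingPatchingRelPerfectConeDepthConeChartsOff
import HarnessLib

/-!
# Crux `PatchingRelPerfect` (stmt-ResolutionOfSingularities-16161), chain W5.2 — rung «r-quadric-ℓ», local algebra: the
# NONDEGENERATE QUADRIC `c₀c₁ + c₂c₃` on the charts of `Bl_𝔪 Spec R` — its strict transform is a GRAPH on every chart, hence has
# simple normal crossings with the exceptional divisor at EVERY prime over `𝔪`

[OURS · L1 W5.2 · rung tool] Replaces the role of NO printed item; NOT a statement of the manuscript under review; fact-free,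
any characteristic, any residue field.  AI-written (AI review is weaker than expert review).

`R` regular local with regular system of parameters `c₀, …, c₃` (`(c) = 𝔪`, `μ(𝔪) = 4`), `q = c₀c₁ + c₂c₃`.  On the chart `B_i`
of `Bl_𝔪 Spec R` (`e_j = c_j/c_i`, `e_i = 1`): `φ(q) = φ(c_i)² · f_i` with `f_i = e₀e₁ + e₂e₃` (`quadFun`, `chartBase_quad`), and
modulo the exceptional parameter `f_i ≡ T_k + T_lT_m` in `κ[T_j : j ≠ i]` (`{i, k} = {0, 1}` or `{2, 3}`), a GRAPH over the
`T_k`-axis: at every prime `𝔓` over `𝔪` the members of `{φ(c_i), f_i}` lying in `𝔓` are part of one regular system of parameters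
of `(B_i)_𝔓` (`quadChart`, from `isRsopPart_kill_hypersurface` with `∂/∂T_k = 1`), and `f_i ≠ φ(c_i)` (`quadFun_ne_chartBase`).
This is the whole local content of the rung «r-quadric-ℓ» `(c₀c₁ + c₂c₃) + 𝔪^{ℓ+2} ∈ 𝒞`: ONE blowing up of the closed point makes
the host smooth and transversal to the exceptional divisor everywhere, and the END of `…ConeDepthLadderClimb` applies at once.
-/

set_option linter.dupNamespace false

noncomputable section

open CategoryTheory CategoryTheory.Limits AlgebraicGeometry TopologicalSpace IsLocalRing
open Literature.AlgebraicGeometry.Resolution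
open Scheme.IdealSheafData
open scoped Pointwise

namespace Summit.ResolutionOfSingularities.ResolutionOfSingularities.Theorems

universe u

namespace ConeDepth

section Quadric

variable {R : Type u} [CommRing R] [IsRegularLocalRing R] (c : Fin 4 → R)
  (hz : Ideal.span (Set.range c) = maximalIdeal R) (hd : (maximalIdeal R).spanFinrank = 4) (i : Fin 4)

local notation3 "Bc" => chartRing c i
local notation3 "φc" => chartBase c i
local notation3 "ec[" j "]" => chartGen c i j

/-- **The nondegenerate quadric on the chart**: `f_i = e₀e₁ + e₂e₃` (with `e_i = 1`). [folklore] -/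
def quadFun : Bc := ec[0] * ec[1] + ec[2] * ec[3]

omit [IsRegularLocalRing R] in
/-- **`φ(q) = φ(c_i)² · f_i`** for the quadric `q = c₀c₁ + c₂c₃`. [folklore] -/
theorem chartBase_quad : φc (c 0 * c 1 + c 2 * c 3) = φc (c i) ^ 2 * quadFun c i := by
  rw [map_add, map_mul, map_mul, reesChartBase_apply_eq_mul_chartGen c i 0, reesChartBase_apply_eq_mul_chartGen c i 1,
    reesChartBase_apply_eq_mul_chartGen c i 2, reesChartBase_apply_eq_mul_chartGen c i 3, quadFun]
  ring

variable (𝔓 : Ideal (chartRing c i)) [𝔓.IsPrime] (h𝔓 : 𝔓.comap (chartBase c i) = maximalIdeal R)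
  (L : Type u) [CommRing L] [IsLocalRing L] [Algebra (chartRing c i) L] [IsLocalization.AtPrime L 𝔓]

include hz hd h𝔓 in
/-- **The quadric chart is a graph**: if modulo the exceptional parameter `f_i ≡ e_k + e_le_m` with `k, l, m ≠ i` pairwise distinct,
then at every prime `𝔓` over `𝔪` the members of `{φ(c_i), f_i}` lying in `𝔓` are part of one regular system of parameters of `L`
(`∂(T_k + T_lT_m)/∂T_k = 1`). [cite: Matsumura1987, Thm. 14.2] -/
theorem quadChart (k l m : Fin 4) (hki : k ≠ i) (hli : l ≠ i) (hmi : m ≠ i) (hkl : k ≠ l) (hkm : k ≠ m)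
    (hquad : Ideal.Quotient.mk (Ideal.span {φc (c i)}) (quadFun c i) =
      Ideal.Quotient.mk (Ideal.span {φc (c i)}) ec[k] +
        Ideal.Quotient.mk (Ideal.span {φc (c i)}) ec[l] * Ideal.Quotient.mk (Ideal.span {φc (c i)}) ec[m]) :
    ∃ (n : ℕ) (v : Fin n → L)
      (ι : {g : chartRing c i // g ∈ [chartBase c i (c i), quadFun c i] ∧ g ∈ 𝔓} → Fin n),
      IsRsopPart v ∧ Function.Injective ι ∧ ∀ g, v (ι g) = (algebraMap (chartRing c i) L : chartRing c i →+* L) g.1 := by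
  classical
  haveI : IsNoetherianRing Bc := isNoetherianRing_blowupChart c i
  have h1P : (1 : chartRing c i) ∉ 𝔓 := fun h => Ideal.IsPrime.ne_top inferInstance ((Ideal.eq_top_iff_one _).mpr h)
  by_cases hf : quadFun c i ∈ 𝔓
  · -- the graph: kill nothing, Jacobian `∂/∂T_k = 1`
    let σ := {j : {j : Fin 4 // j ≠ i} // j ∉ {j : {j : Fin 4 // j ≠ i} | j ∈ ([] : List {j : Fin 4 // j ≠ i})}}
    let tk : σ := ⟨⟨k, hki⟩, fun h => by simp at h⟩
    let tl : σ := ⟨⟨l, hli⟩, fun h => by simp at h⟩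
    let tm : σ := ⟨⟨m, hmi⟩, fun h => by simp at h⟩
    have hkl' : tk ≠ tl := fun h => hkl (congrArg (fun t : σ => t.1.1) h)
    have hkm' : tk ≠ tm := fun h => hkm (congrArg (fun t : σ => t.1.1) h)
    let F : MvPolynomial σ (ResidueField R) := MvPolynomial.X tk + MvPolynomial.X tl * MvPolynomial.X tm
    have hfF : coneε c hz hd i (MvPolynomial.rename Subtype.val F) = Ideal.Quotient.mk _ (quadFun c i) := by
      simp only [F, map_add, map_mul, MvPolynomial.rename_X, coneε_X, hquad, tk, tl, tm]
    have hF0 : F ≠ 0 := by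
      intro h
      have h' := congrArg (MvPolynomial.eval (fun j : σ => if j = tk then (1 : ResidueField R) else 0)) h
      simp only [F, map_add, map_mul, MvPolynomial.eval_X, if_true, if_neg hkl'.symm, map_zero, zero_mul, add_zero] at h'
      exact one_ne_zero h'
    have hGa : coneε c hz hd i (MvPolynomial.rename Subtype.val (MvPolynomial.pderiv tk F)) = Ideal.Quotient.mk _ 1 := by
      simp only [F, map_add, Derivation.leibniz, MvPolynomial.pderiv_X_self, MvPolynomial.pderiv_X_of_ne hkl'.symm,
        MvPolynomial.pderiv_X_of_ne hkm'.symm, smul_zero, add_zero, map_one]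
    have hrs : IsRsopPart (consFamily c i L (chartBase c i) (killFamily i (chartGen c i) [] (quadFun c i))) :=
      isRsopPart_kill_hypersurface c i hz L (chartBase c i) (chartGen c i)
        (reesChartBase_mem_nonZeroDivisors (c i) (Ideal.mem_span_range_self (f := c) (x := i)))
        (coneε c hz hd i) (coneε_X c hz hd i) 𝔓 h𝔓 [] List.nodup_nil (by simp) (quadFun c i) hf F hF0 hfF tk 1 hGa h1P
    exact rsopAdapted_of_consFamily_killFamily c i 𝔓 L [] (quadFun c i) hrs _ (fun g hg _ => by
      simp only [List.mem_cons, List.not_mem_nil, or_false] at hg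
      rcases hg with rfl | rfl
      · exact Or.inl rfl
      · exact Or.inr (Or.inr rfl))
  · -- off the host: only the exceptional parameter
    have hrs := isRsopPart_chartFamily_cone c hz hd i 𝔓 h𝔓 L (a := 0) (fun k => k.elim0)
      (Function.injective_of_subsingleton _) (fun k => k.elim0)
    exact rsopAdapted_of_chartFamily c i 𝔓 L _ hrs _ (fun g hg hgP => by
      simp only [List.mem_cons, List.not_mem_nil, or_false] at hg
      rcases hg with rfl | rfl
      · exact Or.inl rfl
      · exact absurd hgP hf)

include hz hd in
/-- `f_i ≠ φ(c_i)` (modulo the exceptional parameter `f_i ≡ T_k + T_lT_m ≠ 0`). [folklore] -/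
theorem quadFun_ne_chartBase (k l m : Fin 4) (hki : k ≠ i) (hli : l ≠ i) (hmi : m ≠ i) (hkl : k ≠ l)
    (hquad : Ideal.Quotient.mk (Ideal.span {φc (c i)}) (quadFun c i) =
      Ideal.Quotient.mk (Ideal.span {φc (c i)}) ec[k] +
        Ideal.Quotient.mk (Ideal.span {φc (c i)}) ec[l] * Ideal.Quotient.mk (Ideal.span {φc (c i)}) ec[m]) :
    quadFun c i ≠ φc (c i) := by
  classical
  intro h
  let F : MvPolynomial {j : Fin 4 // j ≠ i} (ResidueField R) :=
    MvPolynomial.X ⟨k, hki⟩ + MvPolynomial.X ⟨l, hli⟩ * MvPolynomial.X ⟨m, hmi⟩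
  have hfF : coneε c hz hd i F = Ideal.Quotient.mk _ (quadFun c i) := by
    simp only [F, map_add, map_mul, coneε_X, hquad]
  rw [h, mk_chartBase_self, map_eq_zero_iff _ (coneε c hz hd i).injective] at hfF
  have hkl' : (⟨k, hki⟩ : {j : Fin 4 // j ≠ i}) ≠ ⟨l, hli⟩ := fun h => hkl (congrArg Subtype.val h)
  have h' := congrArg (MvPolynomial.eval (fun j : {j : Fin 4 // j ≠ i} => if j = ⟨k, hki⟩ then (1 : ResidueField R) else 0)) hfF
  simp only [F, map_add, map_mul, MvPolynomial.eval_X, if_true, if_neg hkl'.symm, map_zero, zero_mul, add_zero] at h'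
  exact one_ne_zero h'

omit [IsRegularLocalRing R] in
/-- Chart `0`: `f₀ ≡ e₁ + e₂e₃`. [folklore] -/
theorem mk_quadFun_zero : Ideal.Quotient.mk (Ideal.span {chartBase c 0 (c 0)}) (quadFun c 0) =
    Ideal.Quotient.mk (Ideal.span {chartBase c 0 (c 0)}) (chartGen c 0 1) +
      Ideal.Quotient.mk (Ideal.span {chartBase c 0 (c 0)}) (chartGen c 0 2) *
        Ideal.Quotient.mk (Ideal.span {chartBase c 0 (c 0)}) (chartGen c 0 3) := by
  have h1 : chartGen c 0 0 = 1 := chartGen_self c 0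
  rw [quadFun, map_add, map_mul, map_mul, h1, map_one, one_mul]

omit [IsRegularLocalRing R] in
/-- Chart `1`: `f₁ ≡ e₀ + e₂e₃`. [folklore] -/
theorem mk_quadFun_one : Ideal.Quotient.mk (Ideal.span {chartBase c 1 (c 1)}) (quadFun c 1) =
    Ideal.Quotient.mk (Ideal.span {chartBase c 1 (c 1)}) (chartGen c 1 0) +
      Ideal.Quotient.mk (Ideal.span {chartBase c 1 (c 1)}) (chartGen c 1 2) *
        Ideal.Quotient.mk (Ideal.span {chartBase c 1 (c 1)}) (chartGen c 1 3) := by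
  have h1 : chartGen c 1 1 = 1 := chartGen_self c 1
  rw [quadFun, map_add, map_mul, map_mul, h1, map_one, mul_one]

omit [IsRegularLocalRing R] in
/-- Chart `2`: `f₂ ≡ e₃ + e₀e₁`. [folklore] -/
theorem mk_quadFun_two : Ideal.Quotient.mk (Ideal.span {chartBase c 2 (c 2)}) (quadFun c 2) =
    Ideal.Quotient.mk (Ideal.span {chartBase c 2 (c 2)}) (chartGen c 2 3) +
      Ideal.Quotient.mk (Ideal.span {chartBase c 2 (c 2)}) (chartGen c 2 0) *
        Ideal.Quotient.mk (Ideal.span {chartBase c 2 (c 2)}) (chartGen c 2 1) := by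
  have h1 : chartGen c 2 2 = 1 := chartGen_self c 2
  rw [quadFun, map_add, map_mul, map_mul, h1, map_one, one_mul, add_comm]

omit [IsRegularLocalRing R] in
/-- Chart `3`: `f₃ ≡ e₂ + e₀e₁`. [folklore] -/
theorem mk_quadFun_three : Ideal.Quotient.mk (Ideal.span {chartBase c 3 (c 3)}) (quadFun c 3) =
    Ideal.Quotient.mk (Ideal.span {chartBase c 3 (c 3)}) (chartGen c 3 2) +
      Ideal.Quotient.mk (Ideal.span {chartBase c 3 (c 3)}) (chartGen c 3 0) *
        Ideal.Quotient.mk (Ideal.span {chartBase c 3 (c 3)}) (chartGen c 3 1) := by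
  have h1 : chartGen c 3 3 = 1 := chartGen_self c 3
  rw [quadFun, map_add, map_mul, map_mul, h1, map_one, mul_one, add_comm]

end Quadric

end ConeDepth

end Summit.ResolutionOfSingularities.ResolutionOfSingularities.Theorems

end
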